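import Literature.NumberTheory.Automorphic.CDTTheorem722
import Literature.NumberTheory.GaloisRepresentations.DeformationProfiniteLevel
import HarnessLib

/-!
# STUB-IDEAS companion — `stub_liftThree` — ideator k1 — GEN 11 (Plan 7: the `ℓ = 3` LOCAL SLOT)

Typed helper signatures for Plan 7 of `Cruxes/FreyModularity/STUB-IDEAS-stub_liftThree-1.md`
(gen 11).  Every constructive plan on file for `stub_liftThree` (k1 Plans 2–6, k2 gens 5–8, k3)
silently uses ONE untyped import: the deformation condition AT `3` — Wiles's "flat or ordinary",
DDT's "semistable" class of `ℤ₃[G_{ℚ₃}]`-modules (DDT 1995 §2.4, L.2.22, P.2.23, P.2.27, p. 78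
category `𝒟`, Thm. 3.1 (f)(g)).  k1 gen 8 took it as an abstract `LiftingCondition` `𝒟` (H2), k3
filed it as definition debt D1 (finite flat group schemes), k2 gen 6 used its Selmer count
"`+1` at `p = 3` from `#𝓛₃`" untyped.  This file types it WITHOUT group schemes:

* §A `ModuleClass` — a class of `Γ`-modules closed under sub-objects-of-finite-products and
  quotients (DDT p. 78 (a)(b)(c) / Ramakrishna), and S1: such a class containing `r̄` induces a
  `Deformation.LiftingCondition` (the `𝒟` of k1-g8 H2), tested on Artinian objects;
* §B the cocycle dictionary `ρ_ξ = (1 + εξ) r̄` between lifts to `k[ε]` and `ad`-cocycles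
  (DDT p. 66–67), which turns the slot's count into the tangent-space bound;
* §C S3 (PROVED): the local-term ledger of the Wiles–Greenberg formula — the slot's `≤ #k` at
  `p = 3` is paid for by `#H⁰(ℝ, ad⁰ρ̄) = #k` at `∞` (k2-g6 B4) — giving `#Sel ≤ #k ^ #Q`;
* §D the ONE named `∃`-fact `semistableClassAtThree_nonempty` (DDT L.2.22(a), P.2.23, P.2.27(a),
  Thm. 3.1 (f)(g), Serre 1987 §2.8 for the peu-ramifié criterion, Carayol 1994 Thm. 2 for the
  modular clause) stating, over existing declarations only, that the minimal class `𝒟` and the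
  semistable class `𝒟' ⊇ 𝒟` with the required memberships and the count `≤ #k⁴` (lift currency)
  EXIST.  It replaces k3's definition debt D1; no `def` of "flat" is needed downstream.

Nothing here restates the stub, the crux or the summit; no new axioms; sorries only in the offered
helper lemmas S1, S1', S2a, S2b.
-/

noncomputable section

open scoped MatrixGroups NumberField DualNumber
open Field IsLocalRing
open Literature.NumberTheory.EllipticCurves Literature.NumberTheory.EllipticCurves.ModularForms
open Literature.NumberTheory.Automorphic Literature.NumberTheory.Automorphic.BCDT
open Literature.NumberTheory.GaloisRepresentations
open Literature.NumberTheory.GaloisRepresentations.Deformation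
open WeierstrassCurve

namespace Summit.ABC.ABC.Cruxes.FreyModularity.StubIdeas1g11

universe u

/-! ## §A  Module classes and the lifting condition they induce -/

/-- A **class of `Γ`-modules** in the sense of DDT p. 78 (a)–(c) (= Ramakrishna's / CHT's
"deformation conditions defined by a category of modules"): a predicate on abelian groups with a
`Γ`-action (bare action map; the class may demand additivity itself) which is closed under
**sub-objects of finite products** (a jointly injective finite family of equivariant maps into
members) and under **quotients** (equivariant surjections).  Instances intended (never defined
here): DDT's GOOD (finite flat, Raynaud), ORDINARY and SEMISTABLE finite `ℤ₃[G_{ℚ₃}]`-modules,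
DDT L.2.22(a). [cite: DDT1995, Lemma 2.22 (a) and §2.6 (a)(b)(c) (p. 78)] -/
structure ModuleClass (Γ : Type u) [Group Γ] : Type (u + 1) where
  /-- Membership. -/
  P : ∀ (M : Type u) [AddCommGroup M], (Γ → M → M) → Prop
  /-- Closed under sub-objects of finite products. -/
  of_jointly_injective : ∀ (M : Type u) [AddCommGroup M] (a : Γ → M → M) (ι : Type u) [Finite ι]
      (N : ι → Type u) [∀ i, AddCommGroup (N i)] (b : ∀ i, Γ → N i → N i) (f : ∀ i, M →+ N i),
      (∀ i γ m, f i (a γ m) = b i γ (f i m)) → (∀ m, (∀ i, f i m = 0) → m = 0) →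
      (∀ i, P (N i) (b i)) → P M a
  /-- Closed under quotients. -/
  of_surjective : ∀ (M N : Type u) [AddCommGroup M] [AddCommGroup N] (a : Γ → M → M)
      (b : Γ → N → N) (f : M →+ N), Function.Surjective f →
      (∀ γ m, f (a γ m) = b γ (f m)) → P M a → P N b

/-- `𝒟 ≤ 𝒟'`: every member of `𝒟` is a member of `𝒟'`. [folklore] -/
def ModuleClass.LE {Γ : Type u} [Group Γ] (𝒟 𝒟' : ModuleClass Γ) : Prop :=
  ∀ (M : Type u) [AddCommGroup M] (a : Γ → M → M), 𝒟.P M a → 𝒟'.P M a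

/-- The action on columns `Fin n → R` underlying a matrix representation `ρ : Γ → GL_n(R)`
(`M_ρ` of DDT §2.4). [folklore] -/
def glAct {Γ : Type*} [Group Γ] {R : Type*} [CommRing R] {n : ℕ} (ρ : Γ →* GL (Fin n) R) :
    Γ → (Fin n → R) → (Fin n → R) :=
  fun γ v => ((ρ γ : GL (Fin n) R) : Matrix (Fin n) (Fin n) R).mulVec v

section LiftingConditionOfClass

variable {𝒪 : Type u} [CommRing 𝒪] {k : Type u} [Field k] [Algebra 𝒪 k]
variable {Γ : Type u} [Group Γ] [TopologicalSpace Γ] {n : ℕ} {rbar : Γ →* GL (Fin n) k}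

/-- **S1 (size M).**  A module class `𝒟` containing `M_{r̄}` induces a `LiftingCondition` for `r̄`
(the `𝒟` that k1-gen-8 H2 pulls back along `Γ_{ℚ₃} → Γ_ℚ`), characterised on FINITE (Artinian)
objects `A` by "continuous, reduces to `r̄`, `M_ρ = Aⁿ ∈ 𝒟`"; on a general `A` membership is
membership of all Artinian quotients (DDT p. 64 "in case `R` is not Artinian", p. 78 "type `Σ` iff
`M_ρ` is an object of `𝒟`"; Mazur §23).  Proof: functoriality from quotient-closure (`Bⁿ/𝔪_B^m` is a
quotient of a finite sum of copies of `Aⁿ/I`), detection by jointly injective families from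
sub-of-product closure at finite level — via CHEVALLEY's lemma (`A ∩ 𝔪_B^j ⊆ 𝔪_A^m` for `j ≫ 0`)
to pass from `A ↪ ∏ Bᵢ` to the Artinian quotients; this is where the naive "test on `A/𝔪^m`
only" formulation would FAIL. [cite: DDT1995, §2.4 (p. 64) and §2.6 (p. 78)]
[cite: Mazur1997Deformation, §23] -/
theorem exists_liftingCondition_ofModuleClass [Finite k] [IsNoetherianRing 𝒪] (𝒟 : ModuleClass Γ)
    (hr : 𝒟.P (Fin n → k) (glAct rbar)) (hcont : IsAdicContinuous rbar) :
    ∃ 𝒞 : LiftingCondition 𝒪 k Γ n rbar,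
      ∀ (A : CNLAlgebra 𝒪 k) [Finite A] (ρ : Γ →* GL (Fin n) A),
        ρ ∈ 𝒞.carrier A ↔
          IsAdicContinuous ρ ∧
            (Matrix.GeneralLinearGroup.map (A.residue : A →+* k)).comp ρ = rbar ∧
              𝒟.P (Fin n → A) (glAct ρ) := by
  sorry

/-- **S1' (size XS).**  Module-class conditions are invariant under conjugation (strict
equivalence): `v ↦ g v` is an equivariant additive isomorphism `M_ρ ≅ M_{gρg⁻¹}`.  This is what
makes Mazur's rigidification (`PolarizedDeformationRingProofs`, §Rigidify) legitimate for the slot,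
so that `𝒞^{rigid}(k[ε])` counts DEFORMATIONS (= Selmer classes), not framed lifts (`+3`).
[cite: Mazur1997Deformation, §11 and §23] -/
theorem ModuleClass.P_conj (𝒟 : ModuleClass Γ) {R : Type u} [CommRing R] (ρ : Γ →* GL (Fin n) R)
    (g : GL (Fin n) R) (h : 𝒟.P (Fin n → R) (glAct ρ)) :
    𝒟.P (Fin n → R) (glAct ((MulAut.conj g).toMonoidHom.comp ρ)) := by
  sorry

end LiftingConditionOfClass

/-! ## §B  The cocycle dictionary `ρ_ξ = (1 + ε ξ) r̄` (DDT p. 66–67) -/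

section Cocycle

variable {Γ : Type*} [Group Γ] {R : Type*} [CommRing R] {n : ℕ}

/-- `ξ : Γ → M_n(R)` is a `1`-cocycle for the adjoint action of `r : Γ → GL_n(R)`. [folklore] -/
def IsAdCocycle (r : Γ →* GL (Fin n) R) (ξ : Γ → Matrix (Fin n) (Fin n) R) : Prop :=
  ∀ g h : Γ, ξ (g * h) =
    ξ g + ((r g : GL (Fin n) R) : Matrix (Fin n) (Fin n) R) * ξ h *
      (((r g)⁻¹ : GL (Fin n) R) : Matrix (Fin n) (Fin n) R)

/-- The matrix `r(g) + ε · ξ(g) r(g) ∈ M_n(R[ε])`. [folklore] -/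
def dualNumberMatrix (r : Γ →* GL (Fin n) R) (ξ : Γ → Matrix (Fin n) (Fin n) R) (g : Γ) :
    Matrix (Fin n) (Fin n) R[ε] :=
  ((r g : GL (Fin n) R) : Matrix (Fin n) (Fin n) R).map (fun x => (TrivSqZeroExt.inl x : R[ε])) +
    (ξ g * ((r g : GL (Fin n) R) : Matrix (Fin n) (Fin n) R)).map
      (fun x => (TrivSqZeroExt.inr x : R[ε]))

/-- **S2a (size S).**  `ξ` is an `ad r`-cocycle iff `g ↦ (1 + εξ(g)) r(g)` is a homomorphism
`Γ → GL_n(R[ε])` (then automatically a lift of `r`).  [cite: DDT1995, §2.5 (p. 66–67)] -/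
theorem isAdCocycle_iff_exists_lift (r : Γ →* GL (Fin n) R) (ξ : Γ → Matrix (Fin n) (Fin n) R) :
    IsAdCocycle r ξ ↔ ∃ ρ : Γ →* GL (Fin n) R[ε],
      ∀ g, ((ρ g : GL (Fin n) R[ε]) : Matrix (Fin n) (Fin n) R[ε]) = dualNumberMatrix r ξ g := by
  sorry

/-- **S2b (size S).**  Conversely every lift of `r` to `R[ε]` is `ρ_ξ` for a unique cocycle `ξ`
(`ξ(g) = (ε`-part of `ρ(g)) · r(g)⁻¹`).  With S2a: lifts of `r` to `k[ε]` inside a condition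
`↔` cocycles `Z¹_𝓛`, and `#Z¹_𝓛 = #H¹_𝓛 · #B¹`, `#B¹ = #ad / #H⁰` — the bridge from the slot's
lift count (§D (c)) to k2-g6's `SelmerStructure` currency. [cite: DDT1995, §2.5 (p. 66–67)]
[cite: Mazur1997Deformation, §21] -/
theorem existsUnique_cocycle_of_lift (r : Γ →* GL (Fin n) R) (ρ : Γ →* GL (Fin n) R[ε])
    (hρ : (Matrix.GeneralLinearGroup.map (TrivSqZeroExt.fstHom R R R).toRingHom).comp ρ = r) :
    ∃! ξ : Γ → Matrix (Fin n) (Fin n) R, IsAdCocycle r ξ ∧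
      ∀ g, ((ρ g : GL (Fin n) R[ε]) : Matrix (Fin n) (Fin n) R[ε]) = dualNumberMatrix r ξ g := by
  sorry

end Cocycle

/-! ## §C  S3 — the local-term ledger (PROVED) -/

/-- **S3 (size XS, proved).**  Abstract form of "the local terms cancel" in the Wiles–Greenberg /
DDT Thm. 2.19 product formula (k2-g6 B3 with `#H⁰(ℚ, ad⁰ρ̄) = #H⁰(ℚ, ad⁰ρ̄(1)) = 1` and the dual
Selmer group killed, so that `#Sel · ∏ #H⁰(ℚ_v) = ∏ #𝓛_v`): if place by place
`#𝓛_v · den_v ≤ num_v · #H⁰(ℚ_v)` with `∏ num = K^(q+1)` (`K = #k` at `p = 3` — THE SLOT, DDT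
P.2.27(a) — and at each of the `q = #Q` Taylor–Wiles primes) and `∏ den = K` (the place `∞`:
`#H⁰(ℝ, ad⁰ρ̄) = #k`, `#𝓛_∞ = 1`, k2-g6 B4), then `#Sel ≤ K ^ q`, the input of tangent counting
(`Deformation.exists_cotGen_of_card_algHom_le`, k2-g6 A2: `O[[X₁,…,X_q]] ↠ R_Q`). [folklore] -/
theorem selmer_le_pow_of_local_ledger {ι : Type*} (S : Finset ι) (L H num den : ι → ℕ)
    (sel K q : ℕ) (hK : 0 < K) (hH : ∀ v ∈ S, 0 < H v)
    (hWG : sel * ∏ v ∈ S, H v = ∏ v ∈ S, L v)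
    (hloc : ∀ v ∈ S, L v * den v ≤ num v * H v)
    (hnum : ∏ v ∈ S, num v = K ^ (q + 1)) (hden : ∏ v ∈ S, den v = K) :
    sel ≤ K ^ q := by
  have h1 : (∏ v ∈ S, L v) * ∏ v ∈ S, den v ≤ (∏ v ∈ S, num v) * ∏ v ∈ S, H v := by
    rw [← Finset.prod_mul_distrib, ← Finset.prod_mul_distrib]
    exact Finset.prod_le_prod (fun _ _ => Nat.zero_le _) hloc
  rw [← hWG, hnum, hden, pow_succ] at h1
  have hP : 0 < ∏ v ∈ S, H v := Finset.prod_pos hH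
  have h2 : sel * (K * ∏ v ∈ S, H v) ≤ K ^ q * (K * ∏ v ∈ S, H v) := by
    calc sel * (K * ∏ v ∈ S, H v) = sel * (∏ v ∈ S, H v) * K := by ring
      _ ≤ K ^ q * K * ∏ v ∈ S, H v := h1
      _ = K ^ q * (K * ∏ v ∈ S, H v) := by ring
  exact Nat.le_of_mul_le_mul_right h2 (Nat.mul_pos hK hP)

/-! ## §D  The named `∃`-fact: the semistable slot at `3` exists -/

/-- The restriction `Γ_{ℚ₃} → Γ_ℚ` (tree `absGaloisRestrict`, a fixed choice of `ℚ̄ ↪ ℚ̄₃`).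
[folklore] -/
def resThree : absoluteGaloisGroup ℚ_[3] →* absoluteGaloisGroup ℚ :=
  (absGaloisRestrict ℚ ℚ_[3]).toMonoidHom

/-- `r̄ ⊗_{𝔽₃} k` restricted to `Γ_{ℚ₃}`, for a framed `r̄ : Γ_ℚ → GL₂(𝔽₃)`. [folklore] -/
def localResidual (k : Type) [Field k] [Algebra (ZMod 3) k] (ρ : ModPGaloisRep ℚ (ZMod 3) 2) :
    absoluteGaloisGroup ℚ_[3] →* GL (Fin 2) k :=
  ((Matrix.GeneralLinearGroup.map (algebraMap (ZMod 3) k)).comp ρ.toMonoidHom).comp resThree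

/-- The infinitesimal lifts counted by DDT Prop. 2.27(a), in LIFT currency: continuous lifts of
`r : Γ_{ℚ₃} → GL₂(k)` to `k[ε]` with constant determinant whose module lies in `𝒟`
(`= Z¹_𝒟(ℚ₃, ad⁰ r)` by §B). [cite: DDT1995, §2.5 (p. 66–67)] -/
def tangentLifts (𝒟 : ModuleClass.{0} (absoluteGaloisGroup ℚ_[3])) (k : Type) [Field k]
    (r : absoluteGaloisGroup ℚ_[3] →* GL (Fin 2) k) :
    Set (absoluteGaloisGroup ℚ_[3] →* GL (Fin 2) k[ε]) :=
  {ρ | (Matrix.GeneralLinearGroup.map (TrivSqZeroExt.fstHom k k k).toRingHom).comp ρ = r ∧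
    (∀ g, ((ρ g : GL (Fin 2) k[ε]) : Matrix (Fin 2) (Fin 2) k[ε]).det =
      TrivSqZeroExt.inl (((r g : GL (Fin 2) k) : Matrix (Fin 2) (Fin 2) k).det)) ∧
    IsOpen ((ρ.ker : Subgroup (absoluteGaloisGroup ℚ_[3])) : Set (absoluteGaloisGroup ℚ_[3])) ∧
    𝒟.P (Fin 2 → k[ε]) (glAct ρ)}

/-- **The semistable slot at `3` exists** (named fact, DDT 1995 Ch. 2–3; replaces k3's definition
debt D1 — no finite flat group scheme is DEFINED, only the closure / membership / counting
properties the `R = T` argument consumes are asserted).  For an elliptic `W/ℚ` with `9 ∤ N_W` and a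
framed model `ρ̄` of `W[3]`, absolutely irreducible over `ℚ(√-3)`, there are module classes
`𝒟 ≤ 𝒟'` of `Γ_{ℚ₃}`-modules (intended: `𝒟'` = SEMISTABLE = good-or-ordinary finite
`ℤ₃[G₃]`-modules with their subquotients-of-sums closure, DDT L.2.22(a), p. 78; `𝒟` = the MINIMAL
class of `ρ̄|G₃`: GOOD if `ρ̄|G₃` is good, else ORDINARY) such that:
(a) every `3`-power torsion level `W[3^m]|G₃` lies in `𝒟'` (DDT P.2.23: `W` semistable at `3`), and
  in `𝒟` when `W` has good reduction at `3` (`3 ∤ N_W`) or multiplicative très ramifié reduction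
  (`3 ∣ N_W`, `3 ∤ v₃(Δ_min)`, Serre 1987 §2.8 Prop. 5); `W[3] ⊗ k|G₃ ∈ 𝒟` always;
(b) modular lifts lie in the slot: for a newform `f ∈ S₂(Γ₁(M))`, `9 ∤ M`, and a continuous
  `ρ_A : Γ_ℚ → GL₂(A)` over a finite local `ℤ₃`-algebra `A` attached to `f` away from `3M`
  (`IsGaloisRepOfNewform1Int`) with cyclotomic determinant and reduction `ρ̄ ⊗ k'`, the module
  `A²|G₃` lies in `𝒟'`, and in `𝒟` if `3 ∤ M` (DDT Thm. 3.1 (f) good, (g) ordinary; the passage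
  from Frobenius traces to `ρ_A ≃ ρ_{f,λ} ⊗ A` is Carayol's theorem, residual absolute
  irreducibility coming from `ρ̄`);
(c) COUNT (DDT P.2.27(a) in lift currency, `#Z¹_f = #H¹_f · #ad⁰/#H⁰ ≤ (#H⁰·#k)(#k³/#H⁰)`): for every
  finite field `k ⊇ 𝔽₃` the continuous constant-determinant lifts of `ρ̄ ⊗ k|G₃` to `k[ε]` with
  module in `𝒟` are finite in number, at most `#k ^ 4`.
The relative index of `𝒟'` over `𝒟` (DDT P.2.27(b), `c₃ = (χ₁/χ₂)(Frob₃) - 1`), needed only when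
`3 ∥ N_W` and `ρ̄|G₃` is peu ramifié, is NOT asserted here (see the plan, helper S5).
[cite: DDT1995, Lemma 2.22 (a), Prop. 2.23, Prop. 2.27 (a), §2.6 (p. 78), Thm. 3.1 (f)(g)]
[cite: Serre1987Duke, §2.8 Prop. 5] [cite: Carayol1994, Thm. 2] -/
def semistableClassAtThree_nonempty : Prop :=
  ∀ (W : WeierstrassCurve ℚ) [W.IsElliptic] (ρ : ModPGaloisRep ℚ (ZMod 3) 2),
    W.IsTorsionGaloisRep 3 ρ → ρ.IsAbsIrreducibleOverSqrt (-3) → ¬ 9 ∣ W.conductorNorm ℤ →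
    ∃ 𝒟 𝒟' : ModuleClass.{0} (absoluteGaloisGroup ℚ_[3]), 𝒟.LE 𝒟' ∧
      -- (a) curve side
      (∀ m : ℕ, 𝒟'.P (W.geomTorsion ((3 : ℤ) ^ m)) (fun σ P => resThree σ • P)) ∧
      (¬ 3 ∣ W.conductorNorm ℤ ∨ ¬ 3 ∣ padicValNat 3 (W.minimalDiscriminantNorm ℤ) →
        ∀ m : ℕ, 𝒟.P (W.geomTorsion ((3 : ℤ) ^ m)) (fun σ P => resThree σ • P)) ∧
      (∀ (k : Type) [Field k] [Finite k] [Algebra (ZMod 3) k],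
        𝒟.P (Fin 2 → k) (glAct (localResidual k ρ))) ∧
      -- (b) modular side
      (∀ (A : Type) [CommRing A] [IsLocalRing A] [Finite A] [Algebra ℤ_[3] A] [TopologicalSpace A]
          [DiscreteTopology A] [IsTopologicalRing A] (k' : Type) [Field k'] [Algebra (ZMod 3) k']
          (π : A →+* k') (_ : Function.Surjective π) (M : ℕ) [NeZero M]
          (f : CuspForm (CongruenceSubgroup.Gamma1 M) 2) (_ : IsNewform1 f) (_ : ¬ 9 ∣ M)
          (ι₀ : coeffCharIntegers f →+* A) (ρA : FramedGaloisRep ℚ A 2),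
          IsGaloisRepOfNewform1Int f ι₀ {p | p ∣ 3 * M} ρA →
          (∀ σ, ((ρA σ : GL (Fin 2) A) : Matrix (Fin 2) (Fin 2) A).det =
            algebraMap ℤ_[3] A ((GaloisRep.cyclotomicCharacter ℚ 3 σ : ℤ_[3]ˣ) : ℤ_[3])) →
          (Matrix.GeneralLinearGroup.map π).comp ρA.toMonoidHom =
            (Matrix.GeneralLinearGroup.map (algebraMap (ZMod 3) k')).comp ρ.toMonoidHom →
          𝒟'.P (Fin 2 → A) (glAct (ρA.toMonoidHom.comp resThree)) ∧
            (¬ 3 ∣ M → 𝒟.P (Fin 2 → A) (glAct (ρA.toMonoidHom.comp resThree)))) ∧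
      -- (c) the count, DDT Prop. 2.27(a)
      (∀ (k : Type) [Field k] [Finite k] [Algebra (ZMod 3) k],
        (tangentLifts 𝒟 k (localResidual k ρ)).Finite ∧
          Nat.card (tangentLifts 𝒟 k (localResidual k ρ)) ≤ Nat.card k ^ 4)

end Summit.ABC.ABC.Cruxes.FreyModularity.StubIdeas1g11
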